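import Summits.AtomisticToContinuum.BoseEinsteinCondensation.Theses.BECNudgeWalk
import Literature.MathematicalPhysics.QuantumManyBody.PeriodicClusteringFromKyFanGap
import Literature.MathematicalPhysics.QuantumManyBody.CondensateOccupationStability
import HarnessLib

/-!
# Clustering of nudged near-minimisers from a Ky-Fan gap (Dirichlet box, fixed `N`, `L`)

Crux `BECNudgeWalk.NudgeRemoval` (stmt-AtomisticToContinuum-14361), line `registered`, stub A
`stub_nudgedClustering`: the Dirichlet / nudged twin of
`BoseGas.exists_phase_integral_norm_sub_sq_le_of_kyFanGap` (`PeriodicClusteringFromKyFanGap.lean`).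
For `F(Ψ) = energy v Ψ + s·(N − n₀(Ψ))` on `TrialState N L` (`n₀ = occupation N (constantMode L)`)
with finite infimum `R` and Ky-Fan gap `2R + γ ≤ F(Φ₁) + F(Φ₂)` on `L²`-orthogonal pairs, two
`δ`-near-minimisers satisfy `∫ |Φ − cΦ'|² ≤ 8δ/γ` for a unit `c`. Proof: parallelogram law for the
raw functional `F̃(χ) = Ẽ(χ) + s(N‖χ‖² − n₀(χ))` (degree-two homogeneous; `n₀ ≤ N‖·‖²` by
`condensateOccupation_le_card_mul_lintegral`) on `Φ ± cΦ'`, `c` the phase of `⟨Φ', Φ⟩`, then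
normalisation and `min_toReal_le_of_kyFan_bookkeeping`.
-/

noncomputable section

open MeasureTheory Filter
open scoped ENNReal NNReal ComplexConjugate

namespace Summit.AtomisticToContinuum.BoseEinsteinCondensation.Cruxes.NudgeRemoval.Registered

open Literature.MathematicalPhysics.QuantumManyBody.BoseGas

variable {N : ℕ} {L : ℝ} {v : ℝ → ℝ≥0∞}

/-- The Dirichlet energy integrand `|∇χ|² + W|χ|²` of a continuous `χ` is measurable, for
measurable `v` (cf. `measurable_interaction` of `LiebYngvasonCellMethod.lean`). [folklore] -/
private theorem nr_measurable_integrand (hv : Measurable v) {χ : Config N → ℂ} (hχ : Continuous χ) :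
    Measurable fun X => kineticDensity χ X + interaction v X * ((‖χ X‖₊ : ℝ≥0∞)) ^ 2 := by
  refine (measurable_kineticDensity_of_any χ).add (Measurable.mul ?_ (measurable_coe_nnnorm_sq hχ))
  unfold interaction
  refine Finset.measurable_sum _ fun i _ => Finset.measurable_sum _ fun j _ => ?_
  exact hv.comp ((measurable_pi_apply i).dist (measurable_pi_apply j))

/-- **Parallelogram law for the Dirichlet energy** (all measurable `v`):
`q(φ+ψ) + q(φ-ψ) = 2q(φ) + 2q(ψ)` for `q(χ) = ∫ |∇χ|² + W|χ|²` of `C¹` functions. [folklore] -/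
private theorem nr_lintegral_energy_add_add_sub (hv : Measurable v) {φ ψ : Config N → ℂ}
    (hφ : ContDiff ℝ 1 φ) (hψ : ContDiff ℝ 1 ψ) :
    (∫⁻ X, kineticDensity (fun Y => φ Y + ψ Y) X +
        interaction v X * ((‖φ X + ψ X‖₊ : ℝ≥0∞)) ^ 2) +
    (∫⁻ X, kineticDensity (fun Y => φ Y - ψ Y) X +
        interaction v X * ((‖φ X - ψ X‖₊ : ℝ≥0∞)) ^ 2) =
    2 * (∫⁻ X, kineticDensity φ X + interaction v X * ((‖φ X‖₊ : ℝ≥0∞)) ^ 2) +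
    2 * (∫⁻ X, kineticDensity ψ X + interaction v X * ((‖ψ X‖₊ : ℝ≥0∞)) ^ 2) := by
  have hA := nr_measurable_integrand hv (χ := fun Y => φ Y + ψ Y)
    (hφ.continuous.add hψ.continuous)
  have hC := nr_measurable_integrand hv hφ.continuous
  have hD := nr_measurable_integrand hv hψ.continuous
  rw [← lintegral_add_left hA, ← lintegral_const_mul _ hC, ← lintegral_const_mul _ hD,
    ← lintegral_add_left (hC.const_mul 2)]
  refine lintegral_congr fun X => ?_
  have hk := kineticDensity_fun_add_add_sub (hφ.differentiable one_ne_zero)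
    (hψ.differentiable one_ne_zero) X
  have hn := ennreal_sq_nnnorm_add_add_sub (φ X) (ψ X)
  calc _ = (kineticDensity (fun Y => φ Y + ψ Y) X + kineticDensity (fun Y => φ Y - ψ Y) X) +
        interaction v X *
          (((‖φ X + ψ X‖₊ : ℝ≥0∞)) ^ 2 + ((‖φ X - ψ X‖₊ : ℝ≥0∞)) ^ 2) := by ring
    _ = 2 * (kineticDensity φ X + kineticDensity ψ X) + interaction v X *
          (2 * (((‖φ X‖₊ : ℝ≥0∞)) ^ 2 + ((‖ψ X‖₊ : ℝ≥0∞)) ^ 2)) := by rw [hk, hn]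
    _ = _ := by ring

/-- **Scaling law for the Dirichlet energy**: `q(cψ) = |c|² q(ψ)`. [folklore] -/
private theorem nr_lintegral_energy_const_mul (v : ℝ → ℝ≥0∞) (c : ℂ) {ψ : Config N → ℂ}
    (hψ : ContDiff ℝ 1 ψ) :
    ∫⁻ X, kineticDensity (fun Y => c * ψ Y) X +
        interaction v X * ((‖c * ψ X‖₊ : ℝ≥0∞)) ^ 2 =
      ((‖c‖₊ : ℝ≥0∞)) ^ 2 * ∫⁻ X, kineticDensity ψ X +
        interaction v X * ((‖ψ X‖₊ : ℝ≥0∞)) ^ 2 := by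
  rw [← lintegral_const_mul' _ _ (ENNReal.pow_ne_top ENNReal.coe_ne_top)]
  refine lintegral_congr fun X => ?_
  rw [kineticDensity_fun_const_mul c (hψ.differentiable one_ne_zero) X, nnnorm_mul, ENNReal.coe_mul,
    mul_pow]
  ring

/-- Scaling of the `L²` norm: `‖cψ‖² = |c|²‖ψ‖²`. [folklore] -/
private theorem nr_lintegral_sq_const_mul (c : ℂ) (ψ : Config N → ℂ) :
    ∫⁻ X, ((‖c * ψ X‖₊ : ℝ≥0∞)) ^ 2 = ((‖c‖₊ : ℝ≥0∞)) ^ 2 * ∫⁻ X, ((‖ψ X‖₊ : ℝ≥0∞)) ^ 2 := by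
  rw [← lintegral_const_mul' _ _ (ENNReal.pow_ne_top ENNReal.coe_ne_top)]
  refine lintegral_congr fun X => ?_
  rw [nnnorm_mul, ENNReal.coe_mul, mul_pow]

/-- Parallelogram law for the `L²` norm: `‖φ+ψ‖² + ‖φ-ψ‖² = 2‖φ‖² + 2‖ψ‖²`. [folklore] -/
private theorem nr_lintegral_sq_add_add_sub {φ ψ : Config N → ℂ} (hφ : Continuous φ)
    (hψ : Continuous ψ) :
    (∫⁻ X, ((‖φ X + ψ X‖₊ : ℝ≥0∞)) ^ 2) + (∫⁻ X, ((‖φ X - ψ X‖₊ : ℝ≥0∞)) ^ 2) =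
    2 * (∫⁻ X, ((‖φ X‖₊ : ℝ≥0∞)) ^ 2) + 2 * (∫⁻ X, ((‖ψ X‖₊ : ℝ≥0∞)) ^ 2) := by
  rw [← lintegral_add_left (measurable_coe_nnnorm_sq (χ := fun Y => φ Y + ψ Y) (hφ.add hψ)),
    ← lintegral_const_mul _ (measurable_coe_nnnorm_sq hφ),
    ← lintegral_const_mul _ (measurable_coe_nnnorm_sq hψ),
    ← lintegral_add_left ((measurable_coe_nnnorm_sq hφ).const_mul 2)]
  exact lintegral_congr fun X => by rw [ennreal_sq_nnnorm_add_add_sub, mul_add]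

/-- For a function vanishing off the open box `Λ_L^N` (hence off the cell `[0,L)^{3N}`), the
flat-mode occupation is the condensate occupation of the cell. [folklore] -/
private theorem nr_occupation_eq_condensateOccupation {χ : Config N → ℂ}
    (h0 : ∀ X, X ∉ boxN N L → χ X = 0) :
    occupation N (constantMode L) χ = condensateOccupation N L χ := by
  rw [condensateOccupation]; congr 1; funext X
  by_cases hX : X ∈ cellN N L
  · rw [Set.indicator_of_mem hX]
  · rw [Set.indicator_of_notMem hX, h0 X fun h => hX fun i k => ⟨(h i k).1.le, (h i k).2⟩]

/-- **`n₀ ≤ N‖·‖²`** for continuous functions vanishing off the box. [folklore] -/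
private theorem nr_occupation_le_card_mul (hL : 0 < L) {χ : Config N → ℂ} (hχ : Continuous χ)
    (h0 : ∀ X, X ∉ boxN N L → χ X = 0) :
    occupation N (constantMode L) χ ≤ (N : ℝ≥0∞) * ∫⁻ X, ((‖χ X‖₊ : ℝ≥0∞)) ^ 2 := by
  rw [nr_occupation_eq_condensateOccupation h0]
  exact (condensateOccupation_le_card_mul_lintegral hL hχ).trans
    (mul_le_mul' le_rfl (setLIntegral_le_lintegral _ _))

/-- **Parallelogram law for the condensate occupation** of continuous `(n+1)`-body functions
(`n₀ = ‖a₀ ·‖²` with `a₀` linear). [folklore] -/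
private theorem nr_condensateOccupation_add_add_sub {n : ℕ} (L : ℝ) {φ ψ : Config (n + 1) → ℂ}
    (hφ : Continuous φ) (hψ : Continuous ψ) :
    condensateOccupation (n + 1) L (fun Y => φ Y + ψ Y) +
      condensateOccupation (n + 1) L (fun Y => φ Y - ψ Y) =
    2 * condensateOccupation (n + 1) L φ + 2 * condensateOccupation (n + 1) L ψ := by
  simp only [condensateOccupation_eq_lintegral_modeAn_constantMode]
  have hφm := measurable_constantMode L
  have hφb := norm_constantMode_le L
  have hiφ := fun Y => integrableOn_cell_conj_mul (L := L) hφm hφb (continuous_vecCons_slice hφ Y)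
  have hiψ := fun Y => integrableOn_cell_conj_mul (L := L) hφm hφb (continuous_vecCons_slice hψ Y)
  have hpt : ∀ Y, modeAn L (constantMode L) (fun Y => φ Y + ψ Y) Y =
      modeAn L (constantMode L) φ Y + modeAn L (constantMode L) ψ Y ∧
      modeAn L (constantMode L) (fun Y => φ Y - ψ Y) Y =
      modeAn L (constantMode L) φ Y - modeAn L (constantMode L) ψ Y := by
    intro Y
    simp only [modeAn, mul_add, mul_sub]
    rw [integral_add (hiφ Y) (hiψ Y), mul_add, integral_sub (hiφ Y) (hiψ Y), mul_sub]
    exact ⟨rfl, rfl⟩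
  have hmeas : ∀ {χ : Config (n + 1) → ℂ}, Continuous χ →
      Measurable fun Y => ((‖modeAn L (constantMode L) χ Y‖₊ : ℝ≥0∞)) ^ 2 :=
    fun hχ => ((measurable_modeAn L hφm hχ.measurable).nnnorm.coe_nnreal_ennreal).pow_const 2
  rw [← lintegral_add_left (hmeas (χ := fun Y => φ Y + ψ Y) (hφ.add hψ)),
    ← lintegral_const_mul _ (hmeas hφ), ← lintegral_const_mul _ (hmeas hψ),
    ← lintegral_add_left ((hmeas hφ).const_mul 2)]
  exact lintegral_congr fun Y => by
    rw [(hpt Y).1, (hpt Y).2, ennreal_sq_nnnorm_add_add_sub, mul_add]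

/-- A continuous function vanishing off the box is integrable. [folklore] -/
private theorem nr_integrable {f : Config N → ℂ} (hf : Continuous f)
    (h0 : ∀ X, X ∉ boxN N L → f X = 0) : Integrable f :=
  (integrableOn_cellN hf L).integrable_of_forall_notMem_eq_zero fun X hX =>
    h0 X fun h => hX fun i k => ⟨(h i k).1.le, (h i k).2⟩

/-- `∫ ‖F‖² = (∫⁻ ‖F‖₊²).toReal` for continuous `F`. [folklore] -/
private theorem nr_integral_norm_sq_eq_toReal {F : Config N → ℂ} (hF : Continuous F) :
    ∫ X, ‖F X‖ ^ 2 = (∫⁻ X, ((‖F X‖₊ : ℝ≥0∞)) ^ 2).toReal := by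
  rw [integral_eq_lintegral_of_nonneg_ae (f := fun X => ‖F X‖ ^ 2)
    (Eventually.of_forall fun X => by positivity) ((hF.norm.pow 2).aestronglyMeasurable)]
  simp only [← coe_nnnorm_sq_eq_ofReal]

/-- For a Dirichlet trial state `⟨Ψ, Ψ⟩ = 1` (Bochner form of `Ψ.norm_eq`). [folklore] -/
private theorem nr_integral_conj_mul_self (Ψ : TrialState N L) :
    ∫ X, conj (Ψ.ψ X) * Ψ.ψ X = 1 := by
  have h : (fun X => conj (Ψ.ψ X) * Ψ.ψ X) = fun X => (((‖Ψ.ψ X‖ ^ 2 : ℝ)) : ℂ) := by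
    funext X; rw [Complex.conj_mul', Complex.ofReal_pow]
  rw [h, show (∫ X, (((‖Ψ.ψ X‖ ^ 2 : ℝ)) : ℂ)) = (((∫ X, ‖Ψ.ψ X‖ ^ 2 : ℝ)) : ℂ) from
      integral_ofReal, nr_integral_norm_sq_eq_toReal Ψ.contDiff.continuous, Ψ.norm_eq,
    ENNReal.toReal_one, Complex.ofReal_one]

/-- **Normalising constructor.** A `C¹`, Bose-symmetric `u` vanishing off the box with
`0 < ‖u‖² < ∞` is a positive real multiple `a⁻¹` of a Dirichlet trial state: `Ψ = a u` with
`|a|² = (‖u‖²)⁻¹`. [folklore] -/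
private theorem nr_exists_trialState_const_mul {u : Config N → ℂ} (hu : ContDiff ℝ 1 u)
    (h0u : ∀ X, X ∉ boxN N L → u X = 0)
    (hsymm : ∀ (σ : Equiv.Perm (Fin N)) (X : Config N), u (X ∘ σ) = u X)
    (h0 : ∫⁻ X, ((‖u X‖₊ : ℝ≥0∞)) ^ 2 ≠ 0) (htop : ∫⁻ X, ((‖u X‖₊ : ℝ≥0∞)) ^ 2 ≠ ⊤) :
    ∃ (Ψ : TrialState N L) (a : ℝ), (Ψ.ψ = fun X => (a : ℂ) * u X) ∧
      ((‖(a : ℂ)‖₊ : ℝ≥0∞)) ^ 2 = (∫⁻ X, ((‖u X‖₊ : ℝ≥0∞)) ^ 2)⁻¹ := by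
  set I := ∫⁻ X, ((‖u X‖₊ : ℝ≥0∞)) ^ 2 with hI
  have hIpos : 0 < I.toReal := ENNReal.toReal_pos h0 htop
  set a : ℝ := (Real.sqrt I.toReal)⁻¹ with ha_def
  have ha : ((‖(a : ℂ)‖₊ : ℝ≥0∞)) ^ 2 = I⁻¹ := by
    rw [coe_nnnorm_sq_eq_ofReal, Complex.norm_real, Real.norm_of_nonneg (by positivity), ha_def,
      inv_pow, Real.sq_sqrt hIpos.le, ENNReal.ofReal_inv_of_pos hIpos, ENNReal.ofReal_toReal htop]
  refine ⟨⟨fun X => (a : ℂ) * u X, contDiff_const.mul hu,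
    fun X hX => by simp only [h0u X hX, mul_zero], fun σ X => by simp only [hsymm], ?_⟩,
    a, rfl, ha⟩
  rw [nr_lintegral_sq_const_mul, ha, ENNReal.inv_mul_cancel h0 htop]

/-- Bookkeeping for the depletions `B - O` (`O ≤ B`, genuine differences in `ℝ≥0∞`): they inherit
the parallelogram law from `B` and `O`. [folklore] -/
private theorem nr_tsub_par {Bu Bw B₁ B₂ Ou Ow O₁ O₂ : ℝ≥0∞} (hu : Ou ≤ Bu) (hw : Ow ≤ Bw)
    (h₁ : O₁ ≤ B₁) (h₂ : O₂ ≤ B₂) (hfin : Ou + Ow ≠ ⊤) (hB : Bu + Bw = 2 * B₁ + 2 * B₂)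
    (hO : Ou + Ow = 2 * O₁ + 2 * O₂) :
    (Bu - Ou) + (Bw - Ow) = 2 * (B₁ - O₁) + 2 * (B₂ - O₂) := by
  rw [← ENNReal.add_left_inj hfin]
  calc (Bu - Ou) + (Bw - Ow) + (Ou + Ow) = (Bu - Ou + Ou) + (Bw - Ow + Ow) := by ring
    _ = 2 * (B₁ - O₁ + O₁) + 2 * (B₂ - O₂ + O₂) := by
        rw [tsub_add_cancel_of_le hu, tsub_add_cancel_of_le hw, tsub_add_cancel_of_le h₁,
          tsub_add_cancel_of_le h₂, hB]
    _ = 2 * (B₁ - O₁) + 2 * (B₂ - O₂) + (2 * O₁ + 2 * O₂) := by ring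
    _ = _ := by rw [hO]

/-- Stub A — **clustering of nudged near-minimisers from the Ky-Fan gap** (Dirichlet box, fixed
`N, L`, every measurable `v`, every reward `s ≥ 0`). For `F(Ψ) = energy v Ψ + s·(N − n₀(Ψ))` on
`TrialState N L` with finite infimum `R`: if `2R + γ ≤ F(Φ₁) + F(Φ₂)` for every `L²`-orthogonal pair
of trial states (`γ > 0`), then any two trial states with `F ≤ R + δ` (`δ ≥ 0` real) satisfy
`∫ |Φ − cΦ'|² ≤ 8δ/γ` for some unit complex `c` (the Dirichlet/nudged twin of
`exists_phase_integral_norm_sub_sq_le_of_kyFanGap`: parallelogram law for `Φ ± cΦ'`, `c` the phase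
of `⟨Φ',Φ⟩`, normalisation, Ky-Fan test, `min_toReal_le_of_kyFan_bookkeeping`). [folklore] -/
theorem stub_nudgedClustering : ∀ (v : ℝ → ℝ≥0∞) (N : ℕ) (L s γ : ℝ),
    Measurable v → 0 < N → 0 < L → 0 ≤ s → 0 < γ →
    let F : TrialState N L → ℝ≥0∞ := fun Ψ =>
      energy v Ψ + ENNReal.ofReal s * ((N : ℝ≥0∞) - occupation N (constantMode L) Ψ.ψ)
    (⨅ Ψ : TrialState N L, F Ψ) ≠ ⊤ →
    (∀ Φ₁ Φ₂ : TrialState N L, (∫ X, (starRingEnd ℂ) (Φ₁.ψ X) * Φ₂.ψ X) = 0 →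
        2 * (⨅ Ψ : TrialState N L, F Ψ) + ENNReal.ofReal γ ≤ F Φ₁ + F Φ₂) →
    ∀ δ : ℝ, 0 ≤ δ → ∀ Φ Φ' : TrialState N L,
      F Φ ≤ (⨅ Ψ : TrialState N L, F Ψ) + ENNReal.ofReal δ →
      F Φ' ≤ (⨅ Ψ : TrialState N L, F Ψ) + ENNReal.ofReal δ →
      ∃ c : ℂ, ‖c‖ = 1 ∧ ∫ X, ‖Φ.ψ X - c * Φ'.ψ X‖ ^ 2 ≤ 8 * δ / γ := by
  intro v N L s γ hv hN hL _hs hγ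
  obtain ⟨n, rfl⟩ : ∃ n, N = n + 1 := ⟨N - 1, by omega⟩
  intro F hR hgap δ hδ Φ Φ'
  have hF : ∀ Ψ : TrialState (n + 1) L, F Ψ = energy v Ψ +
      ENNReal.ofReal s * (((n + 1 : ℕ) : ℝ≥0∞) - occupation (n + 1) (constantMode L) Ψ.ψ) :=
    fun Ψ => rfl
  clear_value F
  intro hΦ hΦ'
  set R := ⨅ Ψ : TrialState (n + 1) L, F Ψ with hRdef
  -- the raw functionals `Ẽ`, `‖·‖²`, `n₀` and `F̃ = Ẽ + s (N‖·‖² - n₀)` on functions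
  obtain ⟨E, hE⟩ : ∃ E : (Config (n + 1) → ℂ) → ℝ≥0∞, ∀ χ, E χ =
      ∫⁻ X, kineticDensity χ X + interaction v X * ((‖χ X‖₊ : ℝ≥0∞)) ^ 2 := ⟨_, fun _ => rfl⟩
  obtain ⟨M, hM⟩ : ∃ M : (Config (n + 1) → ℂ) → ℝ≥0∞, ∀ χ, M χ =
      ∫⁻ X, ((‖χ X‖₊ : ℝ≥0∞)) ^ 2 := ⟨_, fun _ => rfl⟩
  obtain ⟨O, hO⟩ : ∃ O : (Config (n + 1) → ℂ) → ℝ≥0∞, ∀ χ, O χ =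
      occupation (n + 1) (constantMode L) χ := ⟨_, fun _ => rfl⟩
  obtain ⟨Ft, hFt⟩ : ∃ Ft : (Config (n + 1) → ℂ) → ℝ≥0∞, ∀ χ, Ft χ =
      E χ + ENNReal.ofReal s * (((n + 1 : ℕ) : ℝ≥0∞) * M χ - O χ) := ⟨_, fun _ => rfl⟩
  have hOM : ∀ χ : Config (n + 1) → ℂ, Continuous χ → (∀ X, X ∉ boxN (n + 1) L → χ X = 0) →
      O χ ≤ ((n + 1 : ℕ) : ℝ≥0∞) * M χ := fun χ hχ h0 => by
    rw [hO, hM]; exact nr_occupation_le_card_mul hL hχ h0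
  have hOt : ∀ {χ : Config (n + 1) → ℂ}, O χ ≤ ((n + 1 : ℕ) : ℝ≥0∞) * M χ → M χ ≠ ⊤ → O χ ≠ ⊤ :=
    fun h ht => ne_top_of_le_ne_top (ENNReal.mul_ne_top (ENNReal.natCast_ne_top _) ht) h
  have hFFt : ∀ Ψ : TrialState (n + 1) L, F Ψ = Ft Ψ.ψ := fun Ψ => by
    rw [hF, hFt, hE, hM, hO, Ψ.norm_eq, mul_one]; rfl
  have hFt_smul : ∀ (a : ℂ) {χ : Config (n + 1) → ℂ}, ContDiff ℝ 1 χ →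
      Ft (fun X => a * χ X) = ((‖a‖₊ : ℝ≥0∞)) ^ 2 * Ft χ := by
    intro a χ hχ
    have ha : ((‖a‖₊ : ℝ≥0∞)) ^ 2 ≠ ⊤ := ENNReal.pow_ne_top ENNReal.coe_ne_top
    rw [hFt, hFt, hE, hE, hM, hM, hO, hO, nr_lintegral_energy_const_mul v a hχ,
      nr_lintegral_sq_const_mul, occupation_const_mul,
      mul_left_comm _ (((‖a‖₊ : ℝ≥0∞)) ^ 2), ← ENNReal.mul_sub (fun _ _ => ha)]
    ring
  have hex : ∀ {U : Config (n + 1) → ℂ}, ContDiff ℝ 1 U → (∀ X, X ∉ boxN (n + 1) L → U X = 0) →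
      (∀ (σ : Equiv.Perm (Fin (n + 1))) (X : Config (n + 1)), U (X ∘ σ) = U X) →
      M U ≠ 0 → M U ≠ ⊤ → ∃ Ψ : TrialState (n + 1) L,
        F Ψ = (M U)⁻¹ * Ft U ∧ ∃ a : ℝ, Ψ.ψ = fun X => (a : ℂ) * U X := by
    intro U hU h0 hsy h0' htop
    rw [hM] at h0' htop
    obtain ⟨Ψ, a, hΨ, ha⟩ := nr_exists_trialState_const_mul hU h0 hsy h0' htop
    refine ⟨Ψ, ?_, a, hΨ⟩
    rw [hFFt, hΨ, hFt_smul (a : ℂ) hU, ha, hM]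
  have hF4 : ∀ {U : Config (n + 1) → ℂ}, ContDiff ℝ 1 U → (∀ X, X ∉ boxN (n + 1) L → U X = 0) →
      (∀ (σ : Equiv.Perm (Fin (n + 1))) (X : Config (n + 1)), U (X ∘ σ) = U X) →
      M U ≠ ⊤ → M U ≠ 0 → R * M U ≤ Ft U := by
    intro U hU h0 hsy htop h0'
    obtain ⟨Ψ, hΨ, -⟩ := hex hU h0 hsy h0' htop
    calc R * M U ≤ F Ψ * M U := mul_le_mul' (by rw [hRdef]; exact iInf_le _ Ψ) le_rfl
      _ = Ft U := by rw [hΨ, mul_comm _⁻¹, mul_assoc, ENNReal.inv_mul_cancel h0' htop, mul_one]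
  -- the phase aligning `Φ'` with `Φ`
  set z : ℂ := ∫ X, conj (Φ'.ψ X) * Φ.ψ X with hz
  set c : ℂ := Complex.exp (↑(Complex.arg z) * Complex.I) with hc
  have hc1 : ‖c‖ = 1 := Complex.norm_exp_ofReal_mul_I _
  have hcc : conj c * c = 1 := by rw [Complex.conj_mul', hc1, Complex.ofReal_one, one_pow]
  have hcz : conj c * z = (‖z‖ : ℂ) := by
    conv_lhs => rw [← Complex.norm_mul_exp_arg_mul_I z, ← hc]
    rw [mul_left_comm, hcc, mul_one]
  have hc2 : ((‖c‖₊ : ℝ≥0∞)) ^ 2 = 1 := by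
    rw [coe_nnnorm_sq_eq_ofReal, hc1, one_pow, ENNReal.ofReal_one]
  have hΦc : Continuous Φ.ψ := Φ.contDiff.continuous
  have hΦ'c : Continuous Φ'.ψ := Φ'.contDiff.continuous
  have hcΦ' : ContDiff ℝ 1 (fun X => c * Φ'.ψ X) := contDiff_const.mul Φ'.contDiff
  have hCu : ContDiff ℝ 1 (fun X => Φ.ψ X + c * Φ'.ψ X) := Φ.contDiff.add hcΦ'
  have hCw : ContDiff ℝ 1 (fun X => Φ.ψ X - c * Φ'.ψ X) := Φ.contDiff.sub hcΦ'
  have h0cΦ' : ∀ X, X ∉ boxN (n + 1) L → c * Φ'.ψ X = 0 := fun X hX => by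
    rw [Φ'.eq_zero X hX, mul_zero]
  have h0u : ∀ X, X ∉ boxN (n + 1) L → (fun X => Φ.ψ X + c * Φ'.ψ X) X = 0 := fun X hX => by
    simp only [Φ.eq_zero X hX, Φ'.eq_zero X hX, mul_zero, add_zero]
  have h0w : ∀ X, X ∉ boxN (n + 1) L → (fun X => Φ.ψ X - c * Φ'.ψ X) X = 0 := fun X hX => by
    simp only [Φ.eq_zero X hX, Φ'.eq_zero X hX, mul_zero, sub_zero]
  have hsymm_u : ∀ (σ : Equiv.Perm (Fin (n + 1))) (X : Config (n + 1)),
      (fun X => Φ.ψ X + c * Φ'.ψ X) (X ∘ σ) = (fun X => Φ.ψ X + c * Φ'.ψ X) X :=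
    fun σ X => by simp only [Φ.symm, Φ'.symm]
  have hsymm_w : ∀ (σ : Equiv.Perm (Fin (n + 1))) (X : Config (n + 1)),
      (fun X => Φ.ψ X - c * Φ'.ψ X) (X ∘ σ) = (fun X => Φ.ψ X - c * Φ'.ψ X) X :=
    fun σ X => by simp only [Φ.symm, Φ'.symm]
  have hFtΦ' : Ft (fun X => c * Φ'.ψ X) = F Φ' := by
    rw [hFt_smul c Φ'.contDiff, hc2, one_mul, hFFt]
  have hnΦ' : ∫⁻ X, ((‖c * Φ'.ψ X‖₊ : ℝ≥0∞)) ^ 2 = 1 := by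
    rw [nr_lintegral_sq_const_mul, Φ'.norm_eq, hc2, one_mul]
  have hMpar : M (fun X => Φ.ψ X + c * Φ'.ψ X) + M (fun X => Φ.ψ X - c * Φ'.ψ X) =
      2 * M Φ.ψ + 2 * M (fun X => c * Φ'.ψ X) := by
    simp only [hM]
    exact nr_lintegral_sq_add_add_sub hΦc hcΦ'.continuous
  have hEpar : E (fun X => Φ.ψ X + c * Φ'.ψ X) + E (fun X => Φ.ψ X - c * Φ'.ψ X) =
      2 * E Φ.ψ + 2 * E (fun X => c * Φ'.ψ X) := by
    simp only [hE]
    exact nr_lintegral_energy_add_add_sub hv Φ.contDiff hcΦ'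
  have hOpar : O (fun X => Φ.ψ X + c * Φ'.ψ X) + O (fun X => Φ.ψ X - c * Φ'.ψ X) =
      2 * O Φ.ψ + 2 * O (fun X => c * Φ'.ψ X) := by
    simp only [hO]
    rw [nr_occupation_eq_condensateOccupation h0u, nr_occupation_eq_condensateOccupation h0w,
      nr_occupation_eq_condensateOccupation (χ := Φ.ψ) Φ.eq_zero,
      nr_occupation_eq_condensateOccupation h0cΦ']
    exact nr_condensateOccupation_add_add_sub L hΦc hcΦ'.continuous
  have hUW : ∫ X, conj ((fun X => Φ.ψ X + c * Φ'.ψ X) X) * (fun X => Φ.ψ X - c * Φ'.ψ X) X = 0 := by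
    have hprod : (fun X => conj (Φ.ψ X + c * Φ'.ψ X) * (Φ.ψ X - c * Φ'.ψ X)) =
        fun X => (conj (Φ.ψ X) * Φ.ψ X - conj c * c * (conj (Φ'.ψ X) * Φ'.ψ X)) +
          (conj c * (conj (Φ'.ψ X) * Φ.ψ X) - conj (conj c * (conj (Φ'.ψ X) * Φ.ψ X))) := by
      funext X; simp only [map_mul, map_add, Complex.conj_conj]; ring
    have hi1 : Integrable (fun X => conj (Φ.ψ X) * Φ.ψ X) :=
      nr_integrable (hΦc.star.mul hΦc) fun X hX => by rw [Φ.eq_zero X hX, mul_zero]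
    have hi4 : Integrable (fun X => conj c * c * (conj (Φ'.ψ X) * Φ'.ψ X)) :=
      nr_integrable (continuous_const.mul (hΦ'c.star.mul hΦ'c)) fun X hX => by
        rw [Φ'.eq_zero X hX, mul_zero, mul_zero]
    have hi3 : Integrable (fun X => conj c * (conj (Φ'.ψ X) * Φ.ψ X)) :=
      nr_integrable (continuous_const.mul (hΦ'c.star.mul hΦc)) fun X hX => by
        rw [Φ.eq_zero X hX, mul_zero, mul_zero]
    have hi2 : Integrable (fun X => conj (conj c * (conj (Φ'.ψ X) * Φ.ψ X))) :=
      nr_integrable (continuous_const.mul (hΦ'c.star.mul hΦc)).star fun X hX => by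
        rw [Φ.eq_zero X hX, mul_zero, mul_zero, map_zero]
    have hi14 : Integrable (fun X => conj (Φ.ψ X) * Φ.ψ X -
        conj c * c * (conj (Φ'.ψ X) * Φ'.ψ X)) := hi1.sub hi4
    have hi32 : Integrable (fun X => conj c * (conj (Φ'.ψ X) * Φ.ψ X) -
        conj (conj c * (conj (Φ'.ψ X) * Φ.ψ X))) := hi3.sub hi2
    beta_reduce
    rw [hprod, integral_add hi14 hi32, integral_sub hi1 hi4, integral_sub hi3 hi2,
      integral_const_mul, integral_const_mul, integral_conj, integral_const_mul,
      nr_integral_conj_mul_self, nr_integral_conj_mul_self, ← hz, hcz, hcc, Complex.conj_ofReal]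
    ring
  have hdist_w : ∫ X, ‖Φ.ψ X - c * Φ'.ψ X‖ ^ 2 = (M fun X => Φ.ψ X - c * Φ'.ψ X).toReal := by
    rw [hM]; exact nr_integral_norm_sq_eq_toReal (F := fun X => Φ.ψ X - c * Φ'.ψ X)
      (hΦc.sub hcΦ'.continuous)
  have hdist_u : ∫ X, ‖Φ.ψ X + c * Φ'.ψ X‖ ^ 2 = (M fun X => Φ.ψ X + c * Φ'.ψ X).toReal := by
    rw [hM]; exact nr_integral_norm_sq_eq_toReal (F := fun X => Φ.ψ X + c * Φ'.ψ X)
      (hΦc.add hcΦ'.continuous)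
  -- from here on `u`, `w` are abstract
  set u : Config (n + 1) → ℂ := fun X => Φ.ψ X + c * Φ'.ψ X
  set w : Config (n + 1) → ℂ := fun X => Φ.ψ X - c * Φ'.ψ X
  clear_value u w
  have hpm : M u + M w = 4 := by
    rw [hMpar, hM, hM, Φ.norm_eq, hnΦ']; norm_num
  have hp_top : M u ≠ ⊤ := ne_top_of_le_ne_top (by norm_num) (hpm ▸ le_self_add)
  have hm_top : M w ≠ ⊤ := ne_top_of_le_ne_top (by norm_num) (hpm ▸ le_add_self)
  have hBpar : ((n + 1 : ℕ) : ℝ≥0∞) * M u + ((n + 1 : ℕ) : ℝ≥0∞) * M w =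
      2 * (((n + 1 : ℕ) : ℝ≥0∞) * M Φ.ψ) +
        2 * (((n + 1 : ℕ) : ℝ≥0∞) * M (fun X => c * Φ'.ψ X)) := by
    rw [← mul_add ((n + 1 : ℕ) : ℝ≥0∞) (M u) (M w), hMpar]; ring
  have hDpar := nr_tsub_par (hOM u hCu.continuous h0u) (hOM w hCw.continuous h0w)
    (hOM _ hΦc Φ.eq_zero) (hOM _ hcΦ'.continuous h0cΦ')
    (ENNReal.add_ne_top.2 ⟨hOt (hOM u hCu.continuous h0u) hp_top,
      hOt (hOM w hCw.continuous h0w) hm_top⟩) hBpar hOpar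
  have hab : Ft u + Ft w ≤ 4 * R + 4 * ENNReal.ofReal δ := by
    have hpar : Ft u + Ft w = 2 * F Φ + 2 * F Φ' := by
      rw [hFFt Φ, ← hFtΦ', hFt, hFt, hFt, hFt, add_add_add_comm, ← mul_add (ENNReal.ofReal s),
        hEpar, hDpar]
      ring
    rw [hpar]
    calc 2 * F Φ + 2 * F Φ' ≤ 2 * (R + ENNReal.ofReal δ) + 2 * (R + ENNReal.ofReal δ) := by gcongr
      _ = _ := by ring
  have hF5 : M u ≠ 0 → M w ≠ 0 →
      2 * R + ENNReal.ofReal γ ≤ (M u)⁻¹ * Ft u + (M w)⁻¹ * Ft w := by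
    intro hp0 hm0
    obtain ⟨û, hEu, a, hûψ⟩ := hex hCu h0u hsymm_u hp0 hp_top
    obtain ⟨ŵ, hEw, b, hŵψ⟩ := hex hCw h0w hsymm_w hm0 hm_top
    have horth : ∫ X, conj (û.ψ X) * ŵ.ψ X = 0 := by
      rw [hûψ, hŵψ]
      have h2 : (fun X => conj ((a : ℂ) * u X) * ((b : ℂ) * w X)) =
          fun X => (conj (a : ℂ) * b) * (conj (u X) * w X) := by
        funext X; simp only [map_mul]; ring
      rw [h2, integral_const_mul, hUW, mul_zero]
    calc 2 * R + ENNReal.ofReal γ ≤ F û + F ŵ := hgap û ŵ horth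
      _ = _ := by rw [hEu, hEw]
  -- bookkeeping: `min(‖u‖², ‖w‖²) ≤ 8δ/γ`
  have key := min_toReal_le_of_kyFan_bookkeeping hγ hδ hR hpm hab (hF4 hCu h0u hsymm_u hp_top)
    (hF4 hCw h0w hsymm_w hm_top) hF5
  rcases le_total (M w).toReal (M u).toReal with h | h
  · exact ⟨c, hc1, by rw [hdist_w]; exact min_eq_right h ▸ key⟩
  · refine ⟨-c, by rw [norm_neg, hc1], ?_⟩
    simp_rw [neg_mul, sub_neg_eq_add]
    rw [hdist_u]
    exact min_eq_left h ▸ key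

end Summit.AtomisticToContinuum.BoseEinsteinCondensation.Cruxes.NudgeRemoval.Registered

end
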